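import Summits.ResolutionOfSingularities.ResolutionOfSingularities.Theorems.InertDescentLU2
import HarnessLib

/-!
# InertDescentLU (3/5) — engine, the tower: regularity DESCENDS through finitely many standard-étale witnesses; the
model corollary

Part 3 of the g28 node `InertDescentLU` of the ROOT/RESIDUAL decomposition cell `decomp-res` (lens 1, window
(W-inert) of critic row 207); see the module docstring of
`Summits.ResolutionOfSingularities.ResolutionOfSingularities.Theorems.InertDescentLU` (part 1/5) for the thesis, the engine
(faithfully flat descent of regularity [Matsumura 23.7 (i)] + standard-étale over normal is normal [Stacks 03GD]),
the law `UnramifiedWitnessLUAbove k O → RelLocalUniformization k K O`, the residual R28, the cuts and the sources.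
Problem side, sorry-free, hypothesis-free.

This part: `isRegularLocalRing_locAtCentre_of_witnesses` (induction on the witnesses: normality and Noetherianity up,
regularity down by part 1's `isRegularLocalRing_of_adjoin_integral`) and `exists_normalModel_regular_of_witnesses`
(the E-frame statement consumed by the law: normal model `k[t₁] ⊇ k[s]`, `(k[t₁ ∪ x′])_𝔪 = (k[s ∪ x′])_𝔪`).
-/

noncomputable section

open IsLocalRing Polynomial Literature.AlgebraicGeometry.Resolution

namespace Summit.ResolutionOfSingularities.ResolutionOfSingularities.Theorems.InertDescentLU

universe u

variable {E : Type u} [Field E] (OE : ValuationSubring E)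

/-! ## PART C — THE TOWER (finitely many witnesses, induction) and the model corollary consumed by the law -/

section Tower

/-- **THE ENGINE (F3⁺ and F2′ discharged, hypothesis-free): regularity DESCENDS through a tower of
standard-étale witnesses over a normal Noetherian base.**  `B ⊆ O_E` with `A = B_𝔪` Noetherian and integrally
closed; `x′ ⊆ O_E` finitely many witnesses, each a root of a MONIC polynomial over `B` whose derivative is a
UNIT at the centre; if `B[x′]` is regular at the centre of `O_E` then so is `B`.  Induction on `x′`: one
witness at a time, normality goes UP (`isIntegrallyClosed_locAtCentre_adjoin`, Stacks 03GD/033C),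
Noetherianity goes up, and at the end regularity comes DOWN each step by faithfully flat descent
(`isRegularLocalRing_of_adjoin_integral`, Matsumura 23.7(i) = tree `IsRegularLocalRing.of_flat_of_isLocalHom`).
No decomposition group, no residue clause, no completion. (Sources: Matsumura1986, Thm. 23.7 (i), p. 181;
StacksProject, Tag 03GD; CossartPiltant2008, Prop. 9.3 (HAL pp. 26–28).) -/
theorem isRegularLocalRing_locAtCentre_of_witnesses (B : Subring E) (hBO : B ≤ OE.toSubring)
    [IsNoetherianRing (locAtCentre B OE)] (hic : IsIntegrallyClosed (locAtCentre B OE)) (s : Finset E)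
    (hw : ∀ x ∈ s, x ∈ OE ∧ ∃ f : E[X], (∀ i, f.coeff i ∈ B) ∧ f.Monic ∧ f.eval x = 0 ∧
      OE.valuation ((derivative f).eval x) = 1)
    (hreg : IsRegularLocalRing (locAtCentre (Subring.closure ((B : Set E) ∪ (s : Set E))) OE)) :
    IsRegularLocalRing (locAtCentre B OE) := by
  classical
  induction s using Finset.induction_on generalizing B with
  | empty =>
    rw [Finset.coe_empty, Set.union_empty, Subring.closure_eq] at hreg
    exact hreg
  | @insert a s ha ih =>
    obtain ⟨haO, f, hfB, hfm, hfa, hder⟩ := hw a (Finset.mem_insert_self a s)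
    have hint : IsIntegral (locAtCentre B OE) a :=
      isIntegral_of_monic_root (locAtCentre B OE) (fun i => le_locAtCentre B OE (hfB i)) hfm hfa
    set B' : Subring E := Subring.closure ((B : Set E) ∪ {a}) with hB'def
    have hB'O : B' ≤ OE.toSubring := closure_insert_le OE hBO haO
    have hBB' : B ≤ B' := fun z hz => Subring.subset_closure (Or.inl hz)
    have haB' : a ∈ B' := Subring.subset_closure (Or.inr rfl)
    have hA'eq : locAtCentre (Algebra.adjoin (locAtCentre B OE) ({a} : Set E)).toSubring OE =
        locAtCentre B' OE := locAtCentre_adjoin_toSubring_eq OE B a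
    haveI : IsNoetherianRing (locAtCentre B' OE) := by
      rw [← hA'eq]; exact isNoetherianRing_locAtCentre_adjoin OE hBO haO
    have hic' : IsIntegrallyClosed (locAtCentre B' OE) := by
      rw [← hA'eq]; exact isIntegrallyClosed_locAtCentre_adjoin OE hBO haO hic hfB hfm hfa hder
    have hw' : ∀ x ∈ s, x ∈ OE ∧ ∃ f : E[X], (∀ i, f.coeff i ∈ B') ∧ f.Monic ∧ f.eval x = 0 ∧
        OE.valuation ((derivative f).eval x) = 1 := fun x hx => by
      obtain ⟨hxO, g, hgB, hgm, hgx, hgd⟩ := hw x (Finset.mem_insert_of_mem hx)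
      exact ⟨hxO, g, fun i => hBB' (hgB i), hgm, hgx, hgd⟩
    have hcl : Subring.closure ((B' : Set E) ∪ (s : Set E)) =
        Subring.closure ((B : Set E) ∪ ((insert a s : Finset E) : Set E)) := by
      apply le_antisymm
      · refine Subring.closure_le.mpr ?_
        rintro z (hz | hz)
        · refine (Subring.closure_le.mpr ?_) hz
          rintro w (hw | hw)
          · exact Subring.subset_closure (Or.inl hw)
          · rw [Set.mem_singleton_iff] at hw
            rw [hw]
            exact Subring.subset_closure (Or.inr (Finset.mem_coe.mpr (Finset.mem_insert_self a s)))
        · exact Subring.subset_closure (Or.inr (Finset.mem_coe.mpr (Finset.mem_insert_of_mem hz)))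
      · refine Subring.closure_le.mpr ?_
        rintro z (hz | hz)
        · exact Subring.subset_closure (Or.inl (hBB' hz))
        · rcases Finset.mem_insert.mp (Finset.mem_coe.mp hz) with rfl | hz
          · exact Subring.subset_closure (Or.inl haB')
          · exact Subring.subset_closure (Or.inr (Finset.mem_coe.mpr hz))
    have hreg' : IsRegularLocalRing (locAtCentre (Subring.closure ((B' : Set E) ∪ (s : Set E))) OE) := by
      rw [hcl]; exact hreg
    have hregA' : IsRegularLocalRing (locAtCentre B' OE) := ih B' hB'O hic' hw' hreg'
    rw [← hA'eq] at hregA'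
    exact isRegularLocalRing_of_adjoin_integral OE hBO haO hic hint hregA'

/-- **THE ENGINE ON MODELS (E-frame corollary consumed by the law).**  `k[s] ⊆ O_E` a model of the subfield
`M = Frac k[s]`, `x′ ⊆ O_E` standard-étale witnesses over `k[s]` (monic, unit derivative at the centre) with
`k[s ∪ x′]` REGULAR at the centre of `O_E`.  Then the NORMAL model `k[t₁] ⊇ k[s]` of `M` (tree
`exists_adjoin_isIntegrallyClosedIn`) is regular at the centre: `t₁ ⊆ (k[s ∪ x′])_𝔪` (a regular local ring is
normal, tree `mem_locAtCentre_of_isIntegral`), so `(k[t₁ ∪ x′])_𝔪 = (k[s ∪ x′])_𝔪` is regular, `(k[t₁])_𝔪` is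
normal (tree `isIntegrallyClosed_locAtCentre`) and Noetherian, and the tower engine descends.  Hypothesis-free.
(Sources: CossartPiltant2008, Prop. 9.3 (HAL pp. 26–28); Matsumura1986, Thm. 23.7 (i), p. 181.) -/
theorem exists_normalModel_regular_of_witnesses (k : Type u) [Field k] [Algebra k E] {M : Subfield E}
    (hkM : ∀ c : k, algebraMap k E c ∈ M) (hkO : ∀ c : k, algebraMap k E c ∈ OE)
    (s : Finset E) (hsM : (s : Set E) ⊆ M) (hsO : ∀ x ∈ s, x ∈ OE)
    (hMs : M ≤ Subfield.closure (Set.range (algebraMap k E) ∪ (s : Set E)))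
    (x' : Finset E)
    (hw : ∀ x ∈ x', x ∈ OE ∧ ∃ f : E[X], (∀ i, f.coeff i ∈ Algebra.adjoin k (s : Set E)) ∧ f.Monic ∧
      f.eval x = 0 ∧ OE.valuation ((derivative f).eval x) = 1)
    (hreg : IsRegularLocalRing
      (locAtCentre (Algebra.adjoin k ((s : Set E) ∪ (x' : Set E))).toSubring OE)) :
    ∃ t₁ : Finset E, (t₁ : Set E) ⊆ M ∧ (s : Set E) ⊆ (t₁ : Set E) ∧
      ∃ _ : (Algebra.adjoin k (t₁ : Set E)).toSubring ≤ OE.toSubring,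
        IsRegularLocalRing (locAtCentre (Algebra.adjoin k (t₁ : Set E)).toSubring OE) := by
  classical
  haveI : IsAdicComplete (maximalIdeal k) k := by
    rw [(isField_iff_maximalIdeal_eq).mp (Field.toIsField k)]; infer_instance
  obtain ⟨t₁, hst₁, ht₁M, ht₁int, hnorm⟩ := exists_adjoin_isIntegrallyClosedIn k E M hkM s hsM hMs
  set T : Subalgebra k E := Algebra.adjoin k ((s : Set E) ∪ (x' : Set E)) with hTdef
  set B₀ : Subalgebra k E := Algebra.adjoin k (t₁ : Set E) with hB₀def
  set U : Subalgebra k E := Algebra.adjoin k ((t₁ : Set E) ∪ (x' : Set E)) with hUdef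
  have hx'O : ∀ x ∈ x', x ∈ OE := fun x hx => (hw x hx).1
  have hsT : Algebra.adjoin k (s : Set E) ≤ T := Algebra.adjoin_mono Set.subset_union_left
  have hTO : T.toSubring ≤ OE.toSubring :=
    model_toSubring_le_valuationSubring OE hkO (fun x hx => hx.elim (hsO x) (hx'O x))
  have hsO' : (Algebra.adjoin k (s : Set E)).toSubring ≤ OE.toSubring := fun x hx => hTO (hsT hx)
  have hB₀O : B₀.toSubring ≤ OE.toSubring :=
    model_toSubring_le_valuationSubring_of_isIntegral OE hkO (s : Set E) hsO'
      (fun x hx => ht₁int x (Finset.mem_coe.mp hx))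
  have hMt₁ : M ≤ Subfield.closure (Set.range (algebraMap k E) ∪ (t₁ : Set E)) :=
    hMs.trans (Subfield.closure_mono (Set.union_subset_union_right _ hst₁))
  -- `t₁ ⊆ S′ = (k[s ∪ x′])_𝔪` (regular ⇒ normal), hence `(k[t₁ ∪ x′])_𝔪 = S′` is regular
  set S' : Subring E := locAtCentre T.toSubring OE with hS'def
  let K₀ : Subfield E := Subfield.closure (Set.range (algebraMap k E) ∪ ((s : Set E) ∪ (x' : Set E)))
  have hTK₀ : T.toSubring ≤ K₀.toSubring := by
    rw [hTdef, Algebra.adjoin_eq_ring_closure]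
    exact Subring.closure_le.mpr fun z hz => Subfield.subset_closure hz
  have hK₀frac : ∀ z ∈ K₀, ∃ a ∈ T.toSubring, ∃ b ∈ T.toSubring, b ≠ 0 ∧ z = a / b := by
    intro z hz
    obtain ⟨y, hy, w, hw0, hyw⟩ := Subfield.mem_closure_iff.mp hz
    rw [← Algebra.adjoin_eq_ring_closure] at hy hw0
    by_cases hw00 : w = 0
    · exact ⟨0, zero_mem _, 1, one_mem _, one_ne_zero, by rw [← hyw, hw00, div_zero, zero_div]⟩
    · exact ⟨y, hy, w, hw0, hw00, hyw.symm⟩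
  have hMK₀ : M ≤ K₀ :=
    hMs.trans (Subfield.closure_mono (Set.union_subset_union_right _ Set.subset_union_left))
  have hTS' : T.toSubring ≤ S' := le_locAtCentre _ OE
  have ht₁S' : ∀ x ∈ (t₁ : Set E), x ∈ S' := fun x hx =>
    mem_locAtCentre_of_isIntegral T OE hreg K₀ hTK₀ hK₀frac (hMK₀ (ht₁M hx))
      (isIntegral_locAtCentre_of_le OE (show (Algebra.adjoin k (s : Set E)).toSubring ≤ T.toSubring from
        fun y hy => hsT hy) (ht₁int x (Finset.mem_coe.mp hx)))
  have hkS' : ∀ c : k, algebraMap k E c ∈ S' := fun c => hTS' (Subalgebra.algebraMap_mem _ c)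
  have hUS' : U.toSubring ≤ S' :=
    model_toSubring_le_of_subset hkS'
      (Set.union_subset ht₁S' (fun x hx => hTS' (Algebra.subset_adjoin (Or.inr hx))))
  have hTU : T.toSubring ≤ U.toSubring := fun y hy =>
    Algebra.adjoin_mono (Set.union_subset_union_left _ hst₁) hy
  have hregU : IsRegularLocalRing (locAtCentre U.toSubring OE) := by
    have hge : locAtCentre U.toSubring OE ≤ S' := by
      have h := locAtCentre_mono OE hUS'
      rw [hS'def, locAtCentre_locAtCentre] at h
      rw [hS'def]; exact h
    have hle : S' ≤ locAtCentre U.toSubring OE := by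
      rw [hS'def]; exact locAtCentre_mono OE hTU
    have hSU : S' = locAtCentre U.toSubring OE := le_antisymm hle hge
    have hreg' : IsRegularLocalRing S' := hreg
    rw [hSU] at hreg'
    exact hreg'
  -- the base `(k[t₁])_𝔪`: Noetherian and integrally closed
  haveI : IsNoetherianRing B₀.toSubring := isNoetherianRing_toSubring_of_fg B₀ ⟨t₁, rfl⟩
  haveI : IsNoetherianRing (locAtCentre B₀.toSubring OE) := isNoetherianRing_locAtCentre OE hB₀O
  have hB₀M : B₀.toSubring ≤ M.toSubring := model_toSubring_le_of_subset (C := M.toSubring) hkM ht₁M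
  have hMfrac : ∀ z ∈ M, ∃ a ∈ B₀.toSubring, ∃ b ∈ B₀.toSubring, b ≠ 0 ∧ z = a / b := by
    intro z hz
    obtain ⟨y, hy, w, hw0, hyw⟩ := Subfield.mem_closure_iff.mp (hMt₁ hz)
    rw [← Algebra.adjoin_eq_ring_closure] at hy hw0
    by_cases hw00 : w = 0
    · exact ⟨0, zero_mem _, 1, one_mem _, one_ne_zero, by rw [← hyw, hw00, div_zero, zero_div]⟩
    · exact ⟨y, hy, w, hw0, hw00, hyw.symm⟩
  have hnorm' : ∀ x ∈ M, IsIntegral B₀.toSubring x → x ∈ B₀.toSubring := fun x hx hxi => hnorm x hx hxi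
  have hic : IsIntegrallyClosed (locAtCentre B₀.toSubring OE) :=
    isIntegrallyClosed_locAtCentre B₀.toSubring M hB₀M hMfrac hnorm' OE hB₀O
  -- witness data over `k[t₁] ⊇ k[s]`, and `k[t₁][x′] = k[t₁ ∪ x′]`
  have hw' : ∀ x ∈ x', x ∈ OE ∧ ∃ f : E[X], (∀ i, f.coeff i ∈ B₀.toSubring) ∧ f.Monic ∧ f.eval x = 0 ∧
      OE.valuation ((derivative f).eval x) = 1 := fun x hx => by
    obtain ⟨hxO, g, hgB, hgm, hgx, hgd⟩ := hw x hx
    exact ⟨hxO, g, fun i => Algebra.adjoin_mono hst₁ (hgB i), hgm, hgx, hgd⟩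
  have hUcl : Subring.closure ((B₀.toSubring : Set E) ∪ (x' : Set E)) = U.toSubring := by
    apply le_antisymm
    · refine Subring.closure_le.mpr ?_
      rintro z (hz | hz)
      · exact Algebra.adjoin_mono Set.subset_union_left (Subalgebra.mem_toSubring.mp hz)
      · exact Algebra.subset_adjoin (Or.inr hz)
    · rw [hUdef, Algebra.adjoin_eq_ring_closure]
      refine Subring.closure_le.mpr ?_
      rintro z (hz | hz | hz)
      · obtain ⟨c, rfl⟩ := hz
        exact Subring.subset_closure (Or.inl (B₀.algebraMap_mem c))
      · exact Subring.subset_closure (Or.inl (Algebra.subset_adjoin hz))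
      · exact Subring.subset_closure (Or.inr hz)
  have hregcl : IsRegularLocalRing
      (locAtCentre (Subring.closure ((B₀.toSubring : Set E) ∪ (x' : Set E))) OE) := by
    rw [hUcl]; exact hregU
  exact ⟨t₁, ht₁M, hst₁, hB₀O,
    isRegularLocalRing_locAtCentre_of_witnesses OE B₀.toSubring hB₀O hic x' hw' hregcl⟩

end Tower

end Summit.ResolutionOfSingularities.ResolutionOfSingularities.Theorems.InertDescentLU

end
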